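import Summits.Ventures.HodgeRepro2.T5BergmanParseval

/-!
# The Fourier coefficients in the weighted Bergman space: `⟨f, zⁿ⟩_k = a_n ⟨zⁿ, zⁿ⟩_k`

For `f = Σ_n a_n zⁿ` in the weighted Bergman space `A_k` (`k ≥ 2`) the pairing with the monomials
recovers the coefficients:

  `⟨f, zⁿ⟩_k = a_n · ⟨zⁿ, zⁿ⟩_k`,   `⟨zⁿ, zⁿ⟩_k = π n! (k-2)! / (n+k-1)!`     (`pairing_monomial_right`)

— by POLARISATION of Parseval's identity (`T5BergmanParseval.hasSum_pairing_self`): `f ± zⁿ` and `f ± i zⁿ`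
are the power series with the `n`-th coefficient shifted by `±1`, `±i`, and
`4 ⟨f, g⟩ = P(f+g) - P(f-g) + i (P(f+ig) - P(f-ig))`, `P(h) = ⟨h, h⟩_k`.  The sesquilinearity of the
pairing on `A_k` (`pairing_add_left`, `pairing_add_right`, …) rests on the integrability of the cross
terms, `|f ḡ| w ≤ (|f|² + |g|²) w / 2`.

Consequently the orthogonal projection of `f` onto the `K`-type `k + 2n` is `a_n zⁿ`, and the Taylor
coefficients of `f ∈ A_k` are its Fourier coefficients with respect to the orthogonal system `(zⁿ)` —
Rühl's `(5-98)` — the statement behind the `K`-type projector of the model.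

Blind lane: Mathlib + the HodgeRepro2 prefix only; no sorry; axioms ⊆ {propext, Classical.choice,
Quot.sound}.
-/

namespace Summit.Ventures.HodgeRepro2.T5BergmanFourier

open MeasureTheory Metric Filter Topology T5BergmanCoefficient T5BergmanPairing T5BergmanUnitary
  T5BergmanCoefficientL2 T5BergmanMonomialNorm T5BergmanParseval
open scoped Real

/-! ### Sesquilinearity on the space -/

/-- The weight `(1 - |z|²)^{k-2}` is non-negative on `𝔻`. -/
lemma weight_nonneg (k : ℕ) {z : ℂ} (hz : z ∈ ball (0 : ℂ) 1) : 0 ≤ (1 - ‖z‖ ^ 2) ^ (k - 2) := by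
  have := mem_ball_zero_iff.mp hz
  have h0 : 0 ≤ 1 - ‖z‖ ^ 2 := by nlinarith [norm_nonneg z]
  positivity

/-- `|a b̄| ≤ (|a|² + |b|²)/2`. -/
lemma norm_mul_conj_le (a b : ℂ) : ‖a * (starRingEnd ℂ) b‖ ≤ (‖a‖ ^ 2 + ‖b‖ ^ 2) / 2 := by
  rw [norm_mul, Complex.norm_conj]
  nlinarith [sq_nonneg (‖a‖ - ‖b‖)]

/-- **Integrability of the cross terms**: for `f, g` continuous on `𝔻` with `|f|² w`, `|g|² w` integrable,
`f ḡ w` is integrable on `𝔻`. -/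
theorem integrableOn_mul_conj (k : ℕ) {f g : ℂ → ℂ} (hf : ContinuousOn f (ball 0 1))
    (hg : ContinuousOn g (ball 0 1))
    (hfi : IntegrableOn (fun z => ‖f z‖ ^ 2 * (1 - ‖z‖ ^ 2) ^ (k - 2)) (ball (0 : ℂ) 1))
    (hgi : IntegrableOn (fun z => ‖g z‖ ^ 2 * (1 - ‖z‖ ^ 2) ^ (k - 2)) (ball (0 : ℂ) 1)) :
    IntegrableOn (fun z => f z * (starRingEnd ℂ) (g z) * (((1 - ‖z‖ ^ 2) ^ (k - 2) : ℝ) : ℂ))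
      (ball (0 : ℂ) 1) := by
  have hmeas : AEStronglyMeasurable
      (fun z => f z * (starRingEnd ℂ) (g z) * (((1 - ‖z‖ ^ 2) ^ (k - 2) : ℝ) : ℂ))
      (volume.restrict (ball (0 : ℂ) 1)) :=
    ((hf.mul (Complex.continuous_conj.comp_continuousOn hg)).mul
      (by fun_prop : Continuous fun z : ℂ => (((1 - ‖z‖ ^ 2) ^ (k - 2) : ℝ) : ℂ)).continuousOn).aestronglyMeasurable
      measurableSet_ball
  have hbound : IntegrableOn
      (fun z => (‖f z‖ ^ 2 * (1 - ‖z‖ ^ 2) ^ (k - 2) + ‖g z‖ ^ 2 * (1 - ‖z‖ ^ 2) ^ (k - 2)) / 2)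
      (ball (0 : ℂ) 1) := (hfi.add hgi).div_const 2
  refine hbound.mono' hmeas ?_
  rw [ae_restrict_iff' measurableSet_ball]
  refine Eventually.of_forall fun z hz => ?_
  have hw := weight_nonneg k hz
  rw [norm_mul, Complex.norm_real, Real.norm_eq_abs, abs_of_nonneg hw]
  have := norm_mul_conj_le (f z) (g z)
  calc ‖f z * (starRingEnd ℂ) (g z)‖ * (1 - ‖z‖ ^ 2) ^ (k - 2)
      ≤ (‖f z‖ ^ 2 + ‖g z‖ ^ 2) / 2 * (1 - ‖z‖ ^ 2) ^ (k - 2) :=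
        mul_le_mul_of_nonneg_right this hw
    _ = (‖f z‖ ^ 2 * (1 - ‖z‖ ^ 2) ^ (k - 2) + ‖g z‖ ^ 2 * (1 - ‖z‖ ^ 2) ^ (k - 2)) / 2 := by ring

/-- `⟨f₁ + f₂, g⟩_k = ⟨f₁, g⟩_k + ⟨f₂, g⟩_k` when both cross terms are integrable. -/
theorem pairing_add_left (k : ℕ) {f₁ f₂ g : ℂ → ℂ}
    (h₁ : IntegrableOn (fun z => f₁ z * (starRingEnd ℂ) (g z) * (((1 - ‖z‖ ^ 2) ^ (k - 2) : ℝ) : ℂ))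
      (ball (0 : ℂ) 1))
    (h₂ : IntegrableOn (fun z => f₂ z * (starRingEnd ℂ) (g z) * (((1 - ‖z‖ ^ 2) ^ (k - 2) : ℝ) : ℂ))
      (ball (0 : ℂ) 1)) :
    pairing k (f₁ + f₂) g = pairing k f₁ g + pairing k f₂ g := by
  unfold pairing
  rw [← integral_add h₁ h₂]
  congr 1
  ext z
  simp only [Pi.add_apply]
  ring

/-- `⟨f, g₁ + g₂⟩_k = ⟨f, g₁⟩_k + ⟨f, g₂⟩_k` when both cross terms are integrable. -/
theorem pairing_add_right (k : ℕ) {f g₁ g₂ : ℂ → ℂ}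
    (h₁ : IntegrableOn (fun z => f z * (starRingEnd ℂ) (g₁ z) * (((1 - ‖z‖ ^ 2) ^ (k - 2) : ℝ) : ℂ))
      (ball (0 : ℂ) 1))
    (h₂ : IntegrableOn (fun z => f z * (starRingEnd ℂ) (g₂ z) * (((1 - ‖z‖ ^ 2) ^ (k - 2) : ℝ) : ℂ))
      (ball (0 : ℂ) 1)) :
    pairing k f (g₁ + g₂) = pairing k f g₁ + pairing k f g₂ := by
  unfold pairing
  rw [← integral_add h₁ h₂]
  congr 1
  ext z
  simp only [Pi.add_apply, map_add]
  ring

/-- `⟨c f, g⟩_k = c ⟨f, g⟩_k` (function form). -/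
theorem pairing_const_mul_left (k : ℕ) (c : ℂ) (f g : ℂ → ℂ) :
    pairing k (fun z => c * f z) g = c * pairing k f g := pairing_smul_left k c f g

/-- `⟨f, c g⟩_k = c̄ ⟨f, g⟩_k` (function form). -/
theorem pairing_const_mul_right (k : ℕ) (c : ℂ) (f g : ℂ → ℂ) :
    pairing k f (fun z => c * g z) = (starRingEnd ℂ) c * pairing k f g := pairing_smul_right k c f g

/-- **The expansion of `P(f + c g)`** for `f, g` in the space: `P(f + cg) = P(f) + 2 Re (c̄ ⟨f, g⟩) + |c|² P(g)`
(as complex numbers, with `P(h) = ⟨h, h⟩_k`). -/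
theorem pairing_self_add_const_mul (k : ℕ) (c : ℂ) {f g : ℂ → ℂ} (hf : ContinuousOn f (ball 0 1))
    (hg : ContinuousOn g (ball 0 1))
    (hfi : IntegrableOn (fun z => ‖f z‖ ^ 2 * (1 - ‖z‖ ^ 2) ^ (k - 2)) (ball (0 : ℂ) 1))
    (hgi : IntegrableOn (fun z => ‖g z‖ ^ 2 * (1 - ‖z‖ ^ 2) ^ (k - 2)) (ball (0 : ℂ) 1)) :
    pairing k (f + fun z => c * g z) (f + fun z => c * g z) =
      pairing k f f + ((starRingEnd ℂ) c * pairing k f g + c * (starRingEnd ℂ) (pairing k f g)) +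
        c * (starRingEnd ℂ) c * pairing k g g := by
  have hcg : ContinuousOn (fun z => c * g z) (ball 0 1) := continuousOn_const.mul hg
  have hcgi : IntegrableOn (fun z => ‖c * g z‖ ^ 2 * (1 - ‖z‖ ^ 2) ^ (k - 2)) (ball (0 : ℂ) 1) := by
    refine IntegrableOn.congr_fun (hgi.const_mul (‖c‖ ^ 2)) (fun z _ => ?_) measurableSet_ball
    simp only [norm_mul, mul_pow]
    ring
  have i11 := integrableOn_mul_conj k hf hf hfi hfi
  have i12 := integrableOn_mul_conj k hf hcg hfi hcgi
  have i21 := integrableOn_mul_conj k hcg hf hcgi hfi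
  have i22 := integrableOn_mul_conj k hcg hcg hcgi hcgi
  rw [pairing_add_left k (f₁ := f) (f₂ := fun z => c * g z) (g := f + fun z => c * g z)
      (by
        have := i11.add i12
        refine this.congr_fun (fun z _ => ?_) measurableSet_ball
        simp only [Pi.add_apply, map_add]
        ring)
      (by
        have := i21.add i22
        refine this.congr_fun (fun z _ => ?_) measurableSet_ball
        simp only [Pi.add_apply, map_add]
        ring),
    pairing_add_right k i11 i12, pairing_add_right k i21 i22, pairing_const_mul_right,
    pairing_const_mul_left, pairing_const_mul_left, pairing_const_mul_right,
    pairing_conj_symm k f g]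
  ring

/-! ### Polarisation -/

/-- **Polarisation**: `4 ⟨f, g⟩_k = P(f+g) - P(f-g) + i (P(f+ig) - P(f-ig))` for `f, g` in the space. -/
theorem pairing_eq_polarization (k : ℕ) {f g : ℂ → ℂ} (hf : ContinuousOn f (ball 0 1))
    (hg : ContinuousOn g (ball 0 1))
    (hfi : IntegrableOn (fun z => ‖f z‖ ^ 2 * (1 - ‖z‖ ^ 2) ^ (k - 2)) (ball (0 : ℂ) 1))
    (hgi : IntegrableOn (fun z => ‖g z‖ ^ 2 * (1 - ‖z‖ ^ 2) ^ (k - 2)) (ball (0 : ℂ) 1)) :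
    4 * pairing k f g =
      (pairing k (f + fun z => (1 : ℂ) * g z) (f + fun z => (1 : ℂ) * g z) -
        pairing k (f + fun z => (-1 : ℂ) * g z) (f + fun z => (-1 : ℂ) * g z)) +
      Complex.I * (pairing k (f + fun z => Complex.I * g z) (f + fun z => Complex.I * g z) -
        pairing k (f + fun z => (-Complex.I) * g z) (f + fun z => (-Complex.I) * g z)) := by
  rw [pairing_self_add_const_mul k 1 hf hg hfi hgi, pairing_self_add_const_mul k (-1) hf hg hfi hgi,
    pairing_self_add_const_mul k Complex.I hf hg hfi hgi,
    pairing_self_add_const_mul k (-Complex.I) hf hg hfi hgi]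
  simp only [map_one, map_neg, Complex.conj_I]
  ring_nf
  rw [Complex.I_sq]
  ring

/-! ### The Fourier coefficients -/

/-- `P(h) = ⟨h, h⟩_k` is real. -/
lemma pairing_self_eq_re (k : ℕ) (h : ℂ → ℂ) : pairing k h h = ((pairing k h h).re : ℂ) := by
  apply Complex.ext
  · simp
  · simp [(pairing_self_nonneg k h).2]

/-- The monomial `zⁿ` is in the space. -/
lemma integrableOn_monomial (k n : ℕ) :
    IntegrableOn (fun z : ℂ => ‖z ^ n‖ ^ 2 * (1 - ‖z‖ ^ 2) ^ (k - 2)) (ball (0 : ℂ) 1) :=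
  ((by fun_prop : Continuous fun z : ℂ => ‖z ^ n‖ ^ 2 * (1 - ‖z‖ ^ 2) ^ (k - 2)).continuousOn.integrableOn_compact
    (isCompact_closedBall 0 1)).mono_set ball_subset_closedBall

/-- `f + c zⁿ` is the power series with `n`-th coefficient `a_n + c`. -/
lemma hasSum_add_const_mul_monomial (a : ℕ → ℂ) (f : ℂ → ℂ)
    (hf : ∀ z ∈ ball (0 : ℂ) 1, HasSum (fun m => a m * z ^ m) (f z)) (c : ℂ) (n : ℕ) {z : ℂ}
    (hz : z ∈ ball (0 : ℂ) 1) :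
    HasSum (fun m => (a m + if m = n then c else 0) * z ^ m) ((f + fun w => c * w ^ n) z) := by
  have h1 : HasSum (fun m => (if m = n then c else 0) * z ^ m) (c * z ^ n) := by
    refine (hasSum_ite_eq n (c * z ^ n)).congr_fun fun m => ?_
    split_ifs with h
    · subst h; rfl
    · simp
  refine ((hf z hz).add h1).congr_fun fun m => ?_
  ring

/-- `P(f + c zⁿ) = P(f) + (|a_n + c|² - |a_n|²) ⟨zⁿ, zⁿ⟩_k` for `f ∈ A_k`. -/
lemma pairing_self_add_monomial_re (k : ℕ) (hk : 2 ≤ k) (a : ℕ → ℂ) (f : ℂ → ℂ)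
    (hf : ∀ z ∈ ball (0 : ℂ) 1, HasSum (fun m => a m * z ^ m) (f z))
    (hint : IntegrableOn (fun z => ‖f z‖ ^ 2 * (1 - ‖z‖ ^ 2) ^ (k - 2)) (ball (0 : ℂ) 1))
    (c : ℂ) (n : ℕ) :
    (pairing k (f + fun w => c * w ^ n) (f + fun w => c * w ^ n)).re =
      (pairing k f f).re + (‖a n + c‖ ^ 2 - ‖a n‖ ^ 2) * monomialNormSq k n := by
  have hP := hasSum_pairing_self k hk a f hf hint
  have hδ : HasSum (fun m => if m = n then (‖a n + c‖ ^ 2 - ‖a n‖ ^ 2) * monomialNormSq k n else 0)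
      ((‖a n + c‖ ^ 2 - ‖a n‖ ^ 2) * monomialNormSq k n) := hasSum_ite_eq n _
  have hsum : HasSum (fun m => ‖a m + (if m = n then c else 0)‖ ^ 2 * monomialNormSq k m)
      ((pairing k f f).re + (‖a n + c‖ ^ 2 - ‖a n‖ ^ 2) * monomialNormSq k n) := by
    refine (hP.add hδ).congr_fun fun m => ?_
    split_ifs with h
    · subst h; ring
    · simp
  have hint' : IntegrableOn (fun z => ‖(f + fun w => c * w ^ n) z‖ ^ 2 * (1 - ‖z‖ ^ 2) ^ (k - 2))
      (ball (0 : ℂ) 1) :=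
    (integrableOn_iff_summable k hk _ _ (fun z hz => hasSum_add_const_mul_monomial a f hf c n hz)).mpr
      hsum.summable
  have hP' := hasSum_pairing_self k hk _ _ (fun z hz => hasSum_add_const_mul_monomial a f hf c n hz) hint'
  exact hP'.unique hsum

/-- `|a+1|² - |a-1|² = 4 Re a` and `|a+i|² - |a-i|² = 4 Im a`. -/
lemma norm_sq_polar (a : ℂ) :
    ‖a + 1‖ ^ 2 - ‖a + -1‖ ^ 2 = 4 * a.re ∧ ‖a + Complex.I‖ ^ 2 - ‖a + -Complex.I‖ ^ 2 = 4 * a.im := by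
  simp only [Complex.sq_norm, Complex.normSq_apply, Complex.add_re, Complex.add_im, Complex.one_re,
    Complex.one_im, Complex.neg_re, Complex.neg_im, Complex.I_re, Complex.I_im]
  constructor <;> ring

/-- **The Fourier coefficients**: `⟨f, zⁿ⟩_k = a_n ⟨zⁿ, zⁿ⟩_k` for `f = Σ a_m zᵐ ∈ A_k` (polarisation of
Parseval). -/
theorem pairing_monomial_right (k : ℕ) (hk : 2 ≤ k) (a : ℕ → ℂ) (f : ℂ → ℂ)
    (hf : ∀ z ∈ ball (0 : ℂ) 1, HasSum (fun m => a m * z ^ m) (f z))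
    (hint : IntegrableOn (fun z => ‖f z‖ ^ 2 * (1 - ‖z‖ ^ 2) ^ (k - 2)) (ball (0 : ℂ) 1)) (n : ℕ) :
    pairing k f (fun w => w ^ n) = a n * monomialNormSq k n := by
  have hfc : ContinuousOn f (ball 0 1) := continuousOn_ball a f hf
  have hpol := pairing_eq_polarization k hfc (by fun_prop : Continuous fun w : ℂ => w ^ n).continuousOn
    hint (integrableOn_monomial k n)
  have e : ∀ c : ℂ, pairing k (f + fun w => c * w ^ n) (f + fun w => c * w ^ n) =
      (((pairing k f f).re + (‖a n + c‖ ^ 2 - ‖a n‖ ^ 2) * monomialNormSq k n : ℝ) : ℂ) := by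
    intro c
    rw [pairing_self_eq_re, pairing_self_add_monomial_re k hk a f hf hint c n]
  rw [e, e, e, e] at hpol
  obtain ⟨h1, h2⟩ := norm_sq_polar (a n)
  have h4 : (4 : ℂ) * pairing k f (fun w => w ^ n) = 4 * (a n * monomialNormSq k n) := by
    rw [hpol]
    simp only [Complex.ofReal_add, Complex.ofReal_mul, Complex.ofReal_sub, Complex.ofReal_pow]
    have e1 : ((‖a n + 1‖ : ℝ) : ℂ) ^ 2 - ((‖a n + -1‖ : ℝ) : ℂ) ^ 2 = 4 * ((a n).re : ℂ) := by
      have := congrArg (fun x : ℝ => (x : ℂ)) h1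
      push_cast at this
      linear_combination this
    have e2 : ((‖a n + Complex.I‖ : ℝ) : ℂ) ^ 2 - ((‖a n + -Complex.I‖ : ℝ) : ℂ) ^ 2 =
        4 * ((a n).im : ℂ) := by
      have := congrArg (fun x : ℝ => (x : ℂ)) h2
      push_cast at this
      linear_combination this
    have e3 : (a n : ℂ) = ((a n).re : ℂ) + ((a n).im : ℂ) * Complex.I := (Complex.re_add_im (a n)).symm
    linear_combination (monomialNormSq k n : ℂ) * e1 + (Complex.I * (monomialNormSq k n : ℂ)) * e2 -
      4 * (monomialNormSq k n : ℂ) * e3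
  have h5 : (4 : ℂ) ≠ 0 := by norm_num
  exact mul_left_cancel₀ h5 h4

/-- The Fourier coefficients of a holomorphic `f ∈ A_k` are its Taylor coefficients:
`⟨f, zⁿ⟩_k = f^{(n)}(0)/n! · ⟨zⁿ, zⁿ⟩_k`. -/
theorem pairing_monomial_right_taylor (k : ℕ) (hk : 2 ≤ k) (f : ℂ → ℂ)
    (hf : DifferentiableOn ℂ f (ball 0 1))
    (hint : IntegrableOn (fun z => ‖f z‖ ^ 2 * (1 - ‖z‖ ^ 2) ^ (k - 2)) (ball (0 : ℂ) 1)) (n : ℕ) :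
    pairing k f (fun w => w ^ n) = taylorCoeff f n * monomialNormSq k n :=
  pairing_monomial_right k hk _ f (hasSum_taylor f hf) hint n

end Summit.Ventures.HodgeRepro2.T5BergmanFourier
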